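import Summits.HodgeConjecture.HodgeConjecture.Theorems.Ring2HypothesesDescentMotivatedStarAdjoint
import Literature.AlgebraicGeometry.Motives.ComplexPointsManifold
import HarnessLib

/-!
# Ring 2 hypotheses, descent face — André's Prop. 2.2 engine: the motivated correspondence
# `*_Θ(Δ_* ηˡ)` inverts `Lˡ` on the top of every Lefschetz string of length `l`

research route conditional on HC_CM; not a corollary; Q11.4-sentence-2 already refuted in dim ≥ 3.
Cell `pub-hodge-ring2` (Hodge ladder STAGE 3), seat `ring2-b05` (binder row b05
`Ring2.Hypotheses.MotivatedImpliesAlgebraicAV`), gen 36. `HC_CM` (`Theses.RankFourFaces.CMAbelianHodge`) does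
not occur in this file; nothing here proves a case of the Hodge conjecture; the row b05 stays OPEN.

André 1996, proof of Prop. 2.2 (p. 16): «il suffit de montrer que pour tout `i ≤ d`, il existe un élément de
`C_mot(X, X)` induisant l'inverse de `L^{d-i}` sur `L^{d-i}Pⁱ(X)`. Considérons `*_{X²}(L^{d-i}) ∈ *_{X²}A(X²) ⊂
A_mot(X × X)` … sur `L^{d-i}Pⁱ(X) ⊗ L^{d-i}Pⁱ(X)`, `*_{X²}` est donnée à un facteur `K ∈ ℚ*` près par `* ⊗ *`
(lemme 1.3.1) … parce que `*` est son propre transposé». On the real carriers, for `X` smooth projective of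
dimension `n`, `η` with the hard Lefschetz property, `Θ = fst^* η + snd^* η` on `X ⊗ X`, orientations `μ`, `ν`
with Poincaré duality, `i + l = n` and the class `c_l = Δ_*(ηˡ) = Δ_*(Lˡ 1) ∈ H^{2n+2l}((X ⊗ X)(ℂ); ℂ)`:

* §1 tools: the top monomial with a free target degree; `Lˡ Δ^*` kills the blocks of primitive pairs of
  different degrees (primitive orthogonality); a sign lemma;
* §2 `cupPairing_corrClassAction_star_gysinDiag` — the MASTER FORMULA
  `⟨(*_Θ c_l)^*(x), y⟩_ν = ± ⟨Lˡ Δ^*(*_Θ(fst^* y ∪ snd^* x)), [X]_ν⟩` (transposition of the two Gysin maps,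
  `cupPairing_gysinMap`, and `*` self-adjoint, `cupProduct_lefschetzInvolution_comm`);
* §3 `exists_cupPairing_corrClassAction_star_eq_mul` — for `p ∈ Pⁱ` and every `y`:
  `⟨(*_Θ c_l)^*(Lˡ p), y⟩ = C_y · ⟨p, y⟩` with `C_y ≠ 0` (only the Lefschetz component of `y` of primitive degree
  `i` survives, by orthogonality and block stability of `*_Θ`; on it Lemme 1.3.1 gives the top constant);
* §4 **`exists_corrClassAction_star_lefschetzPowTo_eq_smul`** — `(*_Θ c_l)^*(Lˡ p) = λ • p` with `λ ≠ 0`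
  (perfectness of the cup pairing of the closed manifold `X(ℂ)`, Hatcher Prop. 3.38): the correspondence
  `*_Θ(c_l)`, which is MOTIVATED (`*` of an algebraic class), inverts `Lˡ` on the top `Lˡ Pⁱ` of the strings of
  length `l`, up to a non-zero scalar.

No definition, no named fact, no sorry. References: Andre1996Motifs (§1.3 Lemme 1.3.1 p. 13, Prop. 2.2 p. 16),
Kleiman1968AlgebraicCycles (§1.4, 1.4.4–1.4.6), VoisinHodgeI2002 (§6.2.3 Cor. 6.26, Lemma 6.29),
FultonYoungTableaux1997 (App. B (5)–(6)), HatcherAT2002 (§3.2 Thm. 3.11, §3.3 Prop. 3.38).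
-/

noncomputable section

-- every declaration of this problem lives in `Summit.HodgeConjecture.HodgeConjecture.…` (summit = sub-problem)
set_option linter.dupNamespace false

open CategoryTheory AlgebraicGeometry MonoidalCategory CartesianMonoidalCategory
open Literature.AlgebraicTopology.SingularHomology Literature.Geometry.Kaehler
open Literature.AlgebraicGeometry Literature.AlgebraicGeometry.Motives
  Literature.AlgebraicGeometry.HodgeTheory

namespace Summit.HodgeConjecture.HodgeConjecture.Theorems

variable {n : ℕ} {X : SchemeOver ℂ} {η : complexBetti X 2}

/-! ## §1 Tools -/

/-- Lemme 1.3.1 (`lefschetzInvolution_boxSum_topMono`) with a free spelling `M` of the target degree `i₁ + i₂`: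
`*_θ (L₁^{m₁} p ⊠ L₂^{m₂} q) = c • (p ⊠ q)` in `Hᴹ`, `c ≠ 0`. [cite: Andre1996Motifs, §1.3 Lemme 1.3.1 (p. 13)] -/
theorem lefschetzInvolution_boxSum_topMono' {d₁ d₂ : ℕ} {V W : SchemeOver ℂ} {η₁ : complexBetti V 2}
    {η₂ : complexBetti W 2} {i₁ i₂ : ℕ} {p : complexBetti V i₁} {q : complexBetti W i₂}
    (hV : IsSmoothProjective d₁ V) (hW : IsSmoothProjective d₂ W)
    (hθ : HasHardLefschetzProperty (complexBetti.map (fst V W) 2 η₁ + complexBetti.map (snd V W) 2 η₂) (d₁ + d₂))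
    (hp : p ∈ primitiveClasses η₁ d₁ i₁) (hq : q ∈ primitiveClasses η₂ d₂ i₂) {m₁ m₂ : ℕ}
    (hm₁ : i₁ + m₁ = d₁) (hm₂ : i₂ + m₂ = d₂) {N M : ℕ} (hN : i₁ + 2 * m₁ + (i₂ + 2 * m₂) = N)
    (hM : i₁ + i₂ = M) (hNM : N + M = 2 * (d₁ + d₂)) :
    ∃ c : ℂ, c ≠ 0 ∧
      lefschetzInvolution hθ hNM
          (cupProduct hN (complexBetti.map (fst V W) (i₁ + 2 * m₁) (lefschetzPowTo η₁ m₁ i₁ (i₁ + 2 * m₁) rfl p))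
            (complexBetti.map (snd V W) (i₂ + 2 * m₂) (lefschetzPowTo η₂ m₂ i₂ (i₂ + 2 * m₂) rfl q))) =
        c • cupProduct hM (complexBetti.map (fst V W) i₁ p) (complexBetti.map (snd V W) i₂ q) := by
  subst hM
  exact lefschetzInvolution_boxSum_topMono hV hW hθ hp hq hm₁ hm₂ hN hNM

/-- **`Lˡ ∘ Δ^*` kills the block of a primitive pair of different degrees** (in the complementary degree): for
`q ∈ P^{i'}`, `p ∈ Pⁱ` primitive for `η` (dimension `n`), `i' ≠ i`, and `w` in the span of the monomials
`fst^*(Lˢ q) ∪ snd^*(Lᵗ p)` of degree `b` with `b + 2l = 2n`: `Lˡ (Δ^* w) = 0` — since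
`Lˡ Δ^*(Lˢ q ⊠ Lᵗ p) = (L^{s+l+t} q) ∪ p = 0` (primitive orthogonality, `cupProduct_lefschetzPowTo_eq_zero_of_ne`).
[cite: VoisinHodgeI2002, §6.2.3 Lemma 6.29] [cite: HatcherAT2002, §3.2 Prop. 3.10] -/
theorem lefschetzPowTo_map_lift_eq_zero_of_mem_block {i i' b l : ℕ} {q : complexBetti X i'} {p : complexBetti X i}
    (hq : q ∈ primitiveClasses η n i') (hp : p ∈ primitiveClasses η n i) (hne : i' ≠ i) (hb : b + 2 * l = 2 * n)
    {w : complexBetti (X ⊗ X) b}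
    (hw : w ∈ Submodule.span ℂ {z : complexBetti (X ⊗ X) b | ∃ (s t : ℕ) (h : i' + 2 * s + (i + 2 * t) = b),
        z = cupProduct h (complexBetti.map (fst X X) (i' + 2 * s) (lefschetzPowTo η s i' (i' + 2 * s) rfl q))
          (complexBetti.map (snd X X) (i + 2 * t) (lefschetzPowTo η t i (i + 2 * t) rfl p))}) :
    lefschetzPowTo η l b (2 * n) hb (complexBetti.map (lift (𝟙 X) (𝟙 X)) b w) = 0 := by
  induction hw using Submodule.span_induction with
  | mem z hz =>
    obtain ⟨s, t, h, rfl⟩ := hz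
    rw [map_lift_cross,
      ← cupProduct_lefschetzPowTo_left η l (rfl : i' + 2 * s + 2 * l = i' + 2 * s + 2 * l) (by omega) h hb,
      lefschetzPowTo_lefschetzPowTo η l rfl rfl (show i' + 2 * (s + l) = i' + 2 * s + 2 * l by omega) q,
      Ring2.AbelianAll.cupProduct_lefschetzPowTo_lefschetzPowTo_left η (s + l) t
        (show i' + 2 * (s + l) = i' + 2 * s + 2 * l by omega) rfl (by omega)
        (rfl : i' + 2 * (s + l + t) = i' + 2 * (s + l + t)) (by omega) q p]
    exact cupProduct_lefschetzPowTo_eq_zero_of_ne hq hp hne rfl (by omega)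
  | zero => rw [map_zero, map_zero]
  | add z z' _ _ hz hz' => rw [map_add, map_add, hz, hz', add_zero]
  | smul a z _ hz => rw [map_smul, map_smul, hz, smul_zero]

/-- Sign lemma: `(Lˡ q) ∪ p = (-1)^{i·i} • (Lˡ p) ∪ q` for `p`, `q ∈ Hⁱ` (graded commutativity; `η` even).
[cite: HatcherAT2002, §3.2 Thm. 3.11] -/
theorem cupProduct_lefschetzPowTo_swap {Y : SchemeOver ℂ} (κ : complexBetti Y 2) {i l a m : ℕ} (ha : i + 2 * l = a)
    (h : a + i = m) (p q : complexBetti Y i) :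
    cupProduct h (lefschetzPowTo κ l i a ha q) p = ((-1 : ℂ) ^ (i * i)) • cupProduct h (lefschetzPowTo κ l i a ha p) q := by
  rw [cupProduct_lefschetzPowTo_left κ l ha h (rfl : i + i = i + i) (by omega) q p,
    cupProduct_gradedComm_holds ℂ (ComplexPoints Y) (rfl : i + i = i + i) rfl q p, map_smul,
    ← cupProduct_lefschetzPowTo_left κ l ha h (rfl : i + i = i + i) (by omega) p q]

/-! ## §2 The master formula -/

/-- **MASTER FORMULA.** `X` smooth projective of dimension `n`, `η ∈ H²(X(ℂ); ℂ)`, `Θ = fst^* η + snd^* η` with the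
hard Lefschetz property on the `2n`-fold `X ⊗ X`, orientations `μ` of `(X ⊗ X)(ℂ)` and `ν` of `X(ℂ)` with Poincaré
duality, `z ∈ H^k(X(ℂ))`, `c = Δ_* z` (the Gysin map of the diagonal, from `ν` to `μ`) of degree `N = a + a`, and
`u = *_Θ c ∈ H^{2e}`. Then for `x`, `y ∈ Hᵃ(X(ℂ))`:
`⟨u^*(x), y⟩_ν = (-1)^{a·a} ⟨z ∪ Δ^*(*_Θ(fst^* y ∪ snd^* x)), [X]_ν⟩` — `⟨u^* x, y⟩ = ± ⟨u ∪ (y ⊠ x)⟩`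
(`cupPairing_corrClassAction`), `(*_Θ c) ∪ v = c ∪ *_Θ v` (`cupProduct_lefschetzInvolution_comm`), and
`⟨Δ_* z ∪ w⟩ = ⟨z ∪ Δ^* w⟩` (`cupPairing_gysinMap`). [cite: Andre1996Motifs, Prop. 2.2 (p. 16)]
[cite: FultonYoungTableaux1997, Appendix B §B.1 (5)–(6)] -/
theorem cupPairing_corrClassAction_star_gysinDiag (hX : IsSmoothProjective n X)
    (hΘ : HasHardLefschetzProperty (complexBetti.map (fst X X) 2 η + complexBetti.map (snd X X) 2 η) (n + n))
    (μ : HomologicalOrientation ℂ (ComplexPoints (X ⊗ X)) (2 * (n + n)))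
    (ν : HomologicalOrientation ℂ (ComplexPoints X) (2 * n)) (hμ : μ.HasPoincareDuality) (hν : ν.HasPoincareDuality)
    {k e a b N : ℕ} (h₁ : k + 2 * e = 2 * n) (h₂ : N + 2 * e = 2 * (n + n)) (hab : a + 2 * e = b + 2 * n)
    (hq : b + a = 2 * n) (hN : a + a = N) (hba : 2 * e + N = 2 * (n + n)) (z : complexBetti X k)
    (x y : complexBetti X a) :
    cupPairing ν hq
        (corrClassAction μ ν hab hq
          (lefschetzInvolution hΘ h₂
            (gysinMap ν μ (AlgPoints.mapContinuous (L := ℂ) (lift (𝟙 X) (𝟙 X))) h₁ h₂ z)) x) y =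
      ((-1 : ℂ) ^ (a * a)) • cupPairing ν h₁ z
        (complexBetti.map (lift (𝟙 X) (𝟙 X)) (2 * e)
          (lefschetzInvolution hΘ h₂
            (cupProduct hN (complexBetti.map (fst X X) a y) (complexBetti.map (snd X X) a x)))) := by
  have hXX : IsSmoothProjective (n + n) (X ⊗ X) := IsSmoothProjective.tensor_holds hX hX
  rw [cupPairing_corrClassAction μ ν hν hab hq hN hba, cupPairing_apply,
    cupProduct_lefschetzInvolution_comm hXX hΘ h₂ hba, ← cupPairing_apply, cupPairing_gysinMap hμ]

/-! ## §3 The pairing computation: only the component of primitive degree `i` survives -/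

/-- **`⟨(*_Θ Δ_* Lˡ1)^*(Lˡ p), y⟩ = C_y · ⟨p, y⟩` with `C_y ≠ 0`.** Setting of the master formula with `z = Lˡ 1`,
`i + l = n`, `p ∈ Pⁱ` primitive, `x = Lˡ p ∈ Hᵃ` (`a = i + 2l`), and any `y ∈ Hᵃ`. Expanding `y = Σ_P Lᵗ ξ_P y`
(Lefschetz decomposition by primitive parts): a component of primitive degree `i' ≠ i` contributes
`⟨Lˡ Δ^* *_Θ(Lᵗ ξ ⊠ Lˡ p)⟩ = 0` — `*_Θ` preserves the block of the primitive pair `(ξ, p)`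
(`lefschetzInvolution_boxSum_mem_block`) and `Lˡ Δ^*` kills it (`lefschetzPowTo_map_lift_eq_zero_of_mem_block`);
the component of index `(i, l)` is the TOP monomial `Lˡ ξ ⊠ Lˡ p` of its block, `*_Θ` of which is `c₀ • (ξ ⊠ p)`,
`c₀ ≠ 0` (Lemme 1.3.1), contributing `c₀ ⟨(Lˡ ξ) ∪ p⟩ = ± c₀ ⟨(Lˡ p) ∪ ξ⟩ = ± c₀ ⟨p, y⟩` (cup-product bridge
`cupProduct_lefschetzPowTo_primitivePart_eq`). [cite: Andre1996Motifs, §1.3 Lemme 1.3.1 (p. 13) and Prop. 2.2 (p. 16)]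
[cite: VoisinHodgeI2002, §6.2.3 Cor. 6.26 and Lemma 6.29] -/
theorem exists_cupPairing_corrClassAction_star_eq_mul (hX : IsSmoothProjective n X) (hL : HasHardLefschetzProperty η n)
    (hΘ : HasHardLefschetzProperty (complexBetti.map (fst X X) 2 η + complexBetti.map (snd X X) 2 η) (n + n))
    (μ : HomologicalOrientation ℂ (ComplexPoints (X ⊗ X)) (2 * (n + n)))
    (ν : HomologicalOrientation ℂ (ComplexPoints X) (2 * n)) (hμ : μ.HasPoincareDuality) (hν : ν.HasPoincareDuality)
    {i l a N : ℕ} (hil : i + l = n) (ha : i + 2 * l = a) (h0 : 0 + 2 * l = 2 * l) (h₁ : 2 * l + 2 * i = 2 * n)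
    (hN : a + a = N) (h₂ : N + 2 * i = 2 * (n + n)) (hab : a + 2 * i = i + 2 * n) (hq : i + a = 2 * n)
    {p : complexBetti X i} (hp : p ∈ primitiveClasses η n i) (y : complexBetti X a) :
    ∃ C : ℂ, C ≠ 0 ∧
      cupPairing ν hq
          (corrClassAction μ ν hab hq
            (lefschetzInvolution hΘ h₂
              (gysinMap ν μ (AlgPoints.mapContinuous (L := ℂ) (lift (𝟙 X) (𝟙 X))) h₁ h₂
                (lefschetzPowTo η l 0 (2 * l) h0 (singularCohomology.one ℂ (ComplexPoints X)))))
            (lefschetzPowTo η l i a ha p)) y =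
        C * cupPairing ν hq p y := by
  classical
  have hvan : ∀ m, 2 * n < m → Subsingleton (complexBetti X m) := fun m hm ↦ subsingleton_complexBetti hX hm
  -- the index of `y`'s component of primitive degree `i`
  let P₀ : {P : ℕ × ℕ // P.1 + 2 * P.2 = a} := ⟨(i, l), ha⟩
  have hq₀p : primitivePart η n hL hvan P₀ y ∈ primitiveClasses η n i := primitivePart_mem hL hvan P₀ y
  -- Lemme 1.3.1 on the top monomial `Lˡ q₀ ⊠ Lˡ p`
  obtain ⟨c₀, hc₀, htop⟩ := lefschetzInvolution_boxSum_topMono' (η₁ := η) (η₂ := η) hX hX hΘ hq₀p hp hil hil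
    (N := N) (by omega) (show i + i = 2 * i by omega) h₂
  refine ⟨(-1 : ℂ) ^ (a * a) * c₀ * (-1 : ℂ) ^ (i * i), by simp [hc₀], ?_⟩
  -- `z ∪ w = Lˡ w` for `z = Lˡ 1`
  have hz : ∀ w : complexBetti X (2 * i),
      cupPairing ν h₁ (lefschetzPowTo η l 0 (2 * l) h0 (singularCohomology.one ℂ (ComplexPoints X))) w =
        kroneckerPairing ℂ ℂ (ComplexPoints X) (2 * n) (lefschetzPowTo η l (2 * i) (2 * n) (by omega) w)
          ν.fundamentalClass := by
    intro w
    rw [cupPairing_apply, cupProduct_lefschetzPowTo_left η l h0 h₁ (Nat.zero_add (2 * i)) (by omega), one_cupProduct]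
  -- master formula, then expand `y`
  rw [cupPairing_corrClassAction_star_gysinDiag hX hΘ μ ν hμ hν h₁ h₂ hab hq hN (by omega), hz]
  conv_lhs => rw [← sum_lefschetzPowTo_primitivePart hL hvan y]
  simp only [map_sum, LinearMap.sum_apply]
  rw [Finset.sum_eq_single P₀]
  · -- the top term
    rw [mono_congr (η₁ := η) (η₂ := η) (p := primitivePart η n hL hvan P₀ y) (q := p) l l ha ha hN
        (by omega : i + 2 * l + (i + 2 * l) = N),
      htop, map_smul, map_smul, map_lift_cross,
      ← cupProduct_lefschetzPowTo_left η l ha (show a + i = 2 * n by omega) (show i + i = 2 * i by omega) (by omega)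
        (primitivePart η n hL hvan P₀ y) p,
      cupProduct_lefschetzPowTo_swap η ha (show a + i = 2 * n by omega) p (primitivePart η n hL hvan P₀ y),
      Ring2.AbelianAll.cupProduct_lefschetzPowTo_primitivePart_eq η hL hvan P₀ hp y hil ha (show a + i = 2 * n by omega)
        (by omega : i + l + 0 = n) (show i + 2 * 0 = i by omega) hq,
      lefschetzPowTo_zero_eq_id, LinearMap.id_apply, cupPairing_apply]
    simp only [map_smul, LinearMap.smul_apply, smul_eq_mul]
    ring
  · -- the other components vanish
    rintro P - hP
    have hne : P.1.1 ≠ i := by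
      intro hPi
      apply hP
      have h2 := P.2
      exact Subtype.ext (Prod.ext hPi (by simp only [P₀]; omega))
    rw [mono_congr (η₁ := η) (η₂ := η) (p := primitivePart η n hL hvan P y) (q := p) P.1.2 l P.2 ha hN
        (by have := P.2; omega : P.1.1 + 2 * P.1.2 + (i + 2 * l) = N),
      lefschetzPowTo_map_lift_eq_zero_of_mem_block (primitivePart_mem hL hvan P y) hp hne (by omega)
        (lefschetzInvolution_boxSum_mem_block hX hX hL hL hΘ (primitivePart_mem hL hvan P y) hp h₂
          (mono_mem_block η η _ p _ _ _ _))]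
    simp only [map_zero, LinearMap.zero_apply]
  · intro h
    exact absurd (Finset.mem_univ _) h

/-! ## §4 The motivated correspondence `*_Θ(Δ_* Lˡ 1)` inverts `Lˡ` on the top of the strings of length `l` -/

/-- **André's Prop. 2.2 engine on the real carriers.** `X` smooth projective of dimension `n`, `η` with the hard
Lefschetz property, `Θ = fst^* η + snd^* η` (hard Lefschetz on `X ⊗ X`), `μ`, `ν` orientations with Poincaré
duality, `i + l = n`, `p ∈ Pⁱ` primitive. Then the correspondence `u = *_Θ(Δ_*(Lˡ 1)) ∈ H^{2i}((X ⊗ X)(ℂ); ℂ)`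
satisfies `u^*(Lˡ p) = λ • p` for some `λ ≠ 0` («un élément … induisant l'inverse de `L^{d-i}` sur
`L^{d-i}Pⁱ(X)`», up to the factor `K`): by §3 the linear forms `⟨u^*(Lˡ p), ·⟩` and `⟨p, ·⟩` on `Hᵃ(X(ℂ))` have
nested kernels, hence are proportional (`exists_eq_smul_of_ker_le`), and the cup pairing of the closed oriented
manifold `X(ℂ)` is perfect (Hatcher Prop. 3.38, `isPerfPair_cupPairing_of_field_holds`).
[cite: Andre1996Motifs, Prop. 2.2 (p. 16)] [cite: Kleiman1968AlgebraicCycles, §1.4 (1.4.4–1.4.6)]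
[cite: HatcherAT2002, §3.3 Prop. 3.38] -/
theorem exists_corrClassAction_star_lefschetzPowTo_eq_smul (hX : IsSmoothProjective n X)
    (hL : HasHardLefschetzProperty η n)
    (hΘ : HasHardLefschetzProperty (complexBetti.map (fst X X) 2 η + complexBetti.map (snd X X) 2 η) (n + n))
    (μ : HomologicalOrientation ℂ (ComplexPoints (X ⊗ X)) (2 * (n + n)))
    (ν : HomologicalOrientation ℂ (ComplexPoints X) (2 * n)) (hμ : μ.HasPoincareDuality) (hν : ν.HasPoincareDuality)
    {i l a N : ℕ} (hil : i + l = n) (ha : i + 2 * l = a) (h0 : 0 + 2 * l = 2 * l) (h₁ : 2 * l + 2 * i = 2 * n)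
    (hN : a + a = N) (h₂ : N + 2 * i = 2 * (n + n)) (hab : a + 2 * i = i + 2 * n) (hq : i + a = 2 * n)
    {p : complexBetti X i} (hp : p ∈ primitiveClasses η n i) :
    ∃ c : ℂ, c ≠ 0 ∧
      corrClassAction μ ν hab hq
          (lefschetzInvolution hΘ h₂
            (gysinMap ν μ (AlgPoints.mapContinuous (L := ℂ) (lift (𝟙 X) (𝟙 X))) h₁ h₂
              (lefschetzPowTo η l 0 (2 * l) h0 (singularCohomology.one ℂ (ComplexPoints X)))))
          (lefschetzPowTo η l i a ha p) = c • p := by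
  set T := corrClassAction μ ν hab hq
    (lefschetzInvolution hΘ h₂
      (gysinMap ν μ (AlgPoints.mapContinuous (L := ℂ) (lift (𝟙 X) (𝟙 X))) h₁ h₂
        (lefschetzPowTo η l 0 (2 * l) h0 (singularCohomology.one ℂ (ComplexPoints X))))) with hT
  have key : ∀ y, ∃ C : ℂ, C ≠ 0 ∧ cupPairing ν hq (T (lefschetzPowTo η l i a ha p)) y = C * cupPairing ν hq p y :=
    fun y ↦ exists_cupPairing_corrClassAction_star_eq_mul hX hL hΘ μ ν hμ hν hil ha h0 h₁ hN h₂ hab hq hp y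
  -- the two linear forms are proportional
  have hker : LinearMap.ker (cupPairing ν hq p) ≤ LinearMap.ker (cupPairing ν hq (T (lefschetzPowTo η l i a ha p))) := by
    intro y hy
    obtain ⟨C, -, hC⟩ := key y
    rw [LinearMap.mem_ker] at hy ⊢
    rw [hC, hy, mul_zero]
  obtain ⟨c, hc⟩ := exists_eq_smul_of_ker_le hker
  -- perfectness of the cup pairing of `X(ℂ)`
  letI := hX.chartedSpace
  haveI := ComplexPoints.compactSpace_of_isSmoothProjective hX
  haveI := ComplexPoints.t2Space_of_isSmoothProjective hX
  have hP : (cupPairing ν hq).IsPerfPair := isPerfPair_cupPairing_of_field_holds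
  have heq : T (lefschetzPowTo η l i a ha p) = c • p := by
    apply hP.bijective_left.1
    rw [map_smul, hc]
  by_cases hp0 : p = 0
  · refine ⟨1, one_ne_zero, ?_⟩
    rw [hp0, map_zero, map_zero, smul_zero]
  · refine ⟨c, ?_, heq⟩
    -- `⟨p, ·⟩ ≠ 0`, so some `⟨p, y⟩ ≠ 0`, and then `⟨T(Lˡ p), y⟩ ≠ 0`
    have hne : cupPairing ν hq p ≠ 0 := fun h0' ↦ hp0 (hP.bijective_left.1 (by rw [h0', map_zero]))
    obtain ⟨y, hy⟩ : ∃ y, cupPairing ν hq p y ≠ 0 :=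
      not_forall.mp fun hall ↦ hne (LinearMap.ext fun y ↦ (hall y).trans (LinearMap.zero_apply y).symm)
    obtain ⟨C, hC0, hC⟩ := key y
    intro hc0
    rw [heq, hc0, zero_smul, map_zero, LinearMap.zero_apply] at hC
    exact (mul_ne_zero hC0 hy) hC.symm

end Summit.HodgeConjecture.HodgeConjecture.Theorems

end
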